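import Literature.NumberTheory.Sieve.CFSemigroupTwistedLY
import HarnessLib

/-!
# The spectral gap of the congruence transfer operator in operator norm (fixed `q`)

Support file (all results proved) for the named fact
`Literature.NumberTheory.Sieve.MageeOhWinter2019_uniformCounting` (`CFSemigroupCounting.lean`).
We lift the real cone gap of `CFSemigroupTwistedGap.lean` and the Lasota–Yorke inequality of
`CFSemigroupTwistedLY.lean` to the Banach space `SL₂(ℤ/qℤ) → CfLip` on which the congruence
transfer operator `𝓜 = cfTwist A hA q δ` of [MageeOhWinter2019, §3.2] acts: with the rank-one
projection `Π_q F = (|Γ_q|⁻¹ Σ_ξ ν(F_ξ)) · h ⊗ 𝟙` (`cfTwPi`),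

* `cfTwist_pow_apply_re_im`: `(𝓜ⁿ F)_ξ(x) = T_n(Re F) + i T_n(Im F)`;
* `norm_cfTwist_pow_apply_sub_le`: uniform convergence `(𝓜ⁿ F)_ξ(x) → (Π_q F)_ξ(x)`;
* `norm_cfTwist_pow_le`: `sup_n ‖𝓜ⁿ‖ < ∞`; `cfTwist_cfTwPi`, `cfTwPi_cfTwist`, `cfTwPi_idem`;
* `cfTwist_opGap`: **`∃ C, r < 1, ‖𝓜ⁿ - Π_q‖ ≤ C rⁿ`** — the fixed-`q` analogue, for the congruence
  transfer operator, of [MageeOhWinter2019, Thm. 10 (3)] (for `q` prime to `6 (b - a)`; the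
  uniformity in `q` of [MageeOhWinter2019, Thm. 4] is NOT addressed). [cite: MageeOhWinter2019, §3.2, Thm. 10]

## References

* M. Magee, H. Oh, D. Winter, J. reine angew. Math. 753 (2019) 89–135, §3.2, Thm. 10. [MageeOhWinter2019]
-/

noncomputable section

open Set MeasureTheory
open scoped MatrixGroups

namespace Literature.NumberTheory.Sieve

variable {A : Finset ℕ}

section OpGap

variable (A) (hA : ∀ a ∈ A, 1 ≤ a) (h2 : 2 ≤ A.card) (q : ℕ) [NeZero q]
include hA

/-! ### Real and imaginary parts -/

omit hA in
/-- The real-part family of a family of Lipschitz functions. [folklore] -/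
def cfReFam (F : SL(2, ZMod q) → CfLip) : SL(2, ZMod q) → ℝ → ℝ := fun ξ y => ((F ξ).extend y).re

omit hA in
/-- The imaginary-part family of a family of Lipschitz functions. [folklore] -/
def cfImFam (F : SL(2, ZMod q) → CfLip) : SL(2, ZMod q) → ℝ → ℝ := fun ξ y => ((F ξ).extend y).im

omit hA in
/-- Sup and Lipschitz bounds of the real/imaginary families by the norm of the family. [folklore] -/
theorem cfReFam_cfImFam_bounds (F : SL(2, ZMod q) → CfLip) :
    (∀ η, ∀ y ∈ Icc (0 : ℝ) 1, |cfReFam q F η y| ≤ ‖F‖) ∧ (∀ η, ∀ y ∈ Icc (0 : ℝ) 1, |cfImFam q F η y| ≤ ‖F‖) ∧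
      (∀ η, ∀ x ∈ Icc (0 : ℝ) 1, ∀ y ∈ Icc (0 : ℝ) 1, |cfReFam q F η x - cfReFam q F η y| ≤ ‖F‖ * |x - y|) ∧
      (∀ η, ∀ x ∈ Icc (0 : ℝ) 1, ∀ y ∈ Icc (0 : ℝ) 1, |cfImFam q F η x - cfImFam q F η y| ≤ ‖F‖ * |x - y|) := by
  have hη : ∀ η, ‖F η‖ ≤ ‖F‖ := fun η => norm_le_pi_norm F η
  refine ⟨fun η y hy => ?_, fun η y hy => ?_, fun η x hx y hy => ?_, fun η x hx y hy => ?_⟩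
  · exact ((cfLip_re_im (F η)).2.2.1 y hy).trans (hη η)
  · exact ((cfLip_re_im (F η)).2.2.2.1 y hy).trans (hη η)
  · exact ((cfLip_re_im (F η)).2.2.2.2.1 x hx y hy).trans (mul_le_mul_of_nonneg_right (hη η) (abs_nonneg _))
  · exact ((cfLip_re_im (F η)).2.2.2.2.2 x hx y hy).trans (mul_le_mul_of_nonneg_right (hη η) (abs_nonneg _))

omit [NeZero q] in
/-- **Real/imaginary decomposition of the twisted sums at `s = δ`.** [folklore] -/
theorem cfTwistSum_re_im (F : SL(2, ZMod q) → CfLip) :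
    ∀ (n : ℕ) (ξ : SL(2, ZMod q)) {x : ℝ}, x ∈ Icc (0 : ℝ) 1 →
      cfTwistSum A q (cfDimension A : ℂ) n F ξ x =
        ((cfTwistSumR A q n (cfReFam q F) ξ x : ℝ) : ℂ) + ((cfTwistSumR A q n (cfImFam q F) ξ x : ℝ) : ℂ) * Complex.I
  | 0, ξ, x, _ => by simp [cfTwistSum, cfTwistSumR, cfReFam, cfImFam, Complex.re_add_im]
  | n + 1, ξ, x, hx => by
      simp only [cfTwistSum, cfTwistSumR]
      push_cast
      rw [Finset.sum_mul, ← Finset.sum_add_distrib]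
      refine Finset.sum_congr rfl fun a _ => ?_
      rw [Finset.sum_mul, ← Finset.sum_add_distrib]
      refine Finset.sum_congr rfl fun b _ => ?_
      have hd := (cfDenom_pair_bounds (hA a a.2) (hA b b.2) hx).1
      rw [cfWt_ofReal _ _ (by linarith), cfTwistSum_re_im F n _ (cfMoeb_pair_mem (hA a a.2) (hA b b.2) hx), cfWtR]
      ring

omit [NeZero q] in
/-- **Powers of `𝓜` in real terms:** `(𝓜ⁿ F)_ξ(x) = T_n(Re F) ξ x + i T_n(Im F) ξ x`. [cite: MageeOhWinter2019, §3.2] -/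
theorem cfTwist_pow_apply_re_im (n : ℕ) (F : SL(2, ZMod q) → CfLip) (ξ : SL(2, ZMod q)) (x : Icc (0 : ℝ) 1) :
    (cfTwist A hA q (cfDimension A : ℂ) ^ n) F ξ x =
      ((cfTwistSumR A q n (cfReFam q F) ξ x : ℝ) : ℂ) + ((cfTwistSumR A q n (cfImFam q F) ξ x : ℝ) : ℂ) * Complex.I := by
  rw [cfTwist_pow_apply, cfTwistSum_re_im A hA q F n ξ x.2]

/-! ### The projection `Π_q` -/

variable {q}

/-- **The spectral projection of the congruence operator:** `Π_q F = (|Γ_q|⁻¹ Σ_ξ ν(F_ξ)) · h ⊗ 𝟙`.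
[cite: MageeOhWinter2019, §3.2] -/
def cfTwPi (h2 : 2 ≤ A.card) : (SL(2, ZMod q) → CfLip) →L[ℂ] (SL(2, ZMod q) → CfLip) :=
  ContinuousLinearMap.smulRight
    ((Fintype.card (SL(2, ZMod q)) : ℂ)⁻¹ • ∑ ξ, (cfNuL A hA h2).comp (ContinuousLinearMap.proj ξ))
    (fun _ => cfHL A hA h2)

/-- Componentwise formula for `Π_q`. [cite: MageeOhWinter2019, §3.2] -/
theorem cfTwPi_apply (F : SL(2, ZMod q) → CfLip) (ξ : SL(2, ZMod q)) :
    cfTwPi A hA h2 F ξ = ((Fintype.card (SL(2, ZMod q)) : ℂ)⁻¹ * ∑ η, cfNuL A hA h2 (F η)) • cfHL A hA h2 := by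
  simp [cfTwPi, ContinuousLinearMap.smulRight_apply]

/-- The coefficient of `Π_q` in real terms: `|Γ|⁻¹ Σ ν(F_η) = avg(Re F) + i avg(Im F)`. [folklore] -/
theorem cfTwPi_coeff_re_im (F : SL(2, ZMod q) → CfLip) :
    (Fintype.card (SL(2, ZMod q)) : ℂ)⁻¹ * ∑ η, cfNuL A hA h2 (F η) =
      ((cfFibAvg A hA h2 (cfReFam q F) : ℝ) : ℂ) + ((cfFibAvg A hA h2 (cfImFam q F) : ℝ) : ℂ) * Complex.I := by
  have hν : ∀ η, cfNuL A hA h2 (F η) =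
      ((cfInt (cfNuδ A hA h2) (cfReFam q F η) : ℝ) : ℂ) + ((cfInt (cfNuδ A hA h2) (cfImFam q F η) : ℝ) : ℂ) * Complex.I := by
    intro η
    obtain ⟨hcu, hcv, -, -, -, -⟩ := cfLip_re_im (F η)
    rw [cfNuL_apply]
    have hpt : ∀ x : Icc (0 : ℝ) 1, F η x = ((cfReFam q F η x : ℝ) : ℂ) + ((cfImFam q F η x : ℝ) : ℂ) * Complex.I := by
      intro x
      rw [← CfLip.extend_coe]
      exact (Complex.re_add_im _).symm
    simp_rw [hpt]
    have hiu : Integrable (fun x : Icc (0 : ℝ) 1 => ((cfReFam q F η x : ℝ) : ℂ)) (cfNuδ A hA h2) :=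
      (cfIntegrable _ hcu.continuousOn).ofReal
    have hiv : Integrable (fun x : Icc (0 : ℝ) 1 => ((cfImFam q F η x : ℝ) : ℂ) * Complex.I) (cfNuδ A hA h2) :=
      (cfIntegrable _ hcv.continuousOn).ofReal.mul_const _
    rw [integral_add hiu hiv, integral_mul_const, integral_complex_ofReal, integral_complex_ofReal]
    rfl
  simp_rw [hν]
  rw [Finset.sum_add_distrib, ← Finset.sum_mul]
  unfold cfFibAvg
  push_cast
  ring

/-! ### Uniform convergence and uniform bounds -/

include h2 in
/-- **Uniform convergence `(𝓜ⁿ F)_ξ(x) → (Π_q F)_ξ(x)`** at the rate of the real cone gap.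
[cite: MageeOhWinter2019, §3.2, Thm. 10] -/
theorem norm_cfTwist_pow_apply_sub_le {n₀ : ℕ}
    (hprim : ∀ n ≥ n₀, ∀ ξ η : SL(2, ZMod q), ∃ w : List (A × A), w.length = n ∧ ξ * cfSigmaWord A q w = η)
    {N : ℕ} (hN : n₀ ≤ N) (hN1 : 1 ≤ N) (F : SL(2, ZMod q) → CfLip) (n : ℕ) (ξ : SL(2, ZMod q)) (x : Icc (0 : ℝ) 1) :
    ‖(cfTwist A hA q (cfDimension A : ℂ) ^ n) F ξ x - cfTwPi A hA h2 F ξ x‖ ≤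
      20 * ((4 : ℝ) ^ cfDimension A * (Real.exp (4 * cfDimension A + 2) * Fintype.card (SL(2, ZMod q)) +
        Real.exp (2 * cfDimension A))) * (1 - cfTwEta A N) ^ (n / N) * ‖F‖ := by
  obtain ⟨hbu, hbv, hlu, hlv⟩ := cfReFam_cfImFam_bounds q F
  have hF0 := norm_nonneg F
  have hdu := cfTwistSumR_decay_lipschitz A hA h2 hprim hN hN1 hF0 hF0 hbu hlu n ξ x.2
  have hdv := cfTwistSumR_decay_lipschitz A hA h2 hprim hN hN1 hF0 hF0 hbv hlv n ξ x.2
  rw [cfTwist_pow_apply_re_im, cfTwPi_apply, CfLip.smul_apply, cfHL_apply, cfTwPi_coeff_re_im]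
  set Tu := cfTwistSumR A q n (cfReFam q F) ξ x
  set Tv := cfTwistSumR A q n (cfImFam q F) ξ x
  set Iu := cfFibAvg A hA h2 (cfReFam q F)
  set Iv := cfFibAvg A hA h2 (cfImFam q F)
  set hx' := cfHδ A hA h2 x
  set C := 5 * ((4 : ℝ) ^ cfDimension A * (Real.exp (4 * cfDimension A + 2) * Fintype.card (SL(2, ZMod q)) +
        Real.exp (2 * cfDimension A))) * (‖F‖ + ‖F‖) * (1 - cfTwEta A N) ^ (n / N)
  have e : ((Tu : ℝ) : ℂ) + ((Tv : ℝ) : ℂ) * Complex.I - (((Iu : ℝ) : ℂ) + ((Iv : ℝ) : ℂ) * Complex.I) * ((hx' : ℝ) : ℂ) =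
      (((Tu - Iu * hx' : ℝ)) : ℂ) + (((Tv - Iv * hx' : ℝ)) : ℂ) * Complex.I := by
    push_cast; ring
  rw [e]
  calc ‖(((Tu - Iu * hx' : ℝ)) : ℂ) + (((Tv - Iv * hx' : ℝ)) : ℂ) * Complex.I‖
      ≤ ‖(((Tu - Iu * hx' : ℝ)) : ℂ)‖ + ‖(((Tv - Iv * hx' : ℝ)) : ℂ) * Complex.I‖ := norm_add_le _ _
    _ = |Tu - Iu * hx'| + |Tv - Iv * hx'| := by
        rw [norm_mul, Complex.norm_I, mul_one, Complex.norm_real, Complex.norm_real, Real.norm_eq_abs, Real.norm_eq_abs]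
    _ ≤ C + C := add_le_add hdu hdv
    _ = _ := by simp only [C]; ring

include h2 in
/-- **Uniform sup and Lipschitz bounds for the powers:** `|(𝓜ⁿF)_ξ(x)| ≤ 2·4^δ ‖F‖` and
`Lip((𝓜ⁿF)_ξ) ≤ 2·4^δ (4δe^{4δ} + 1) ‖F‖`. [cite: MageeOhWinter2019, Lemma 15] -/
theorem cfTwist_pow_apply_bounds (n : ℕ) (F : SL(2, ZMod q) → CfLip) (ξ : SL(2, ZMod q)) :
    (∀ x : Icc (0 : ℝ) 1, ‖(cfTwist A hA q (cfDimension A : ℂ) ^ n) F ξ x‖ ≤ 2 * (4 : ℝ) ^ cfDimension A * ‖F‖) ∧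
      ∀ x y : Icc (0 : ℝ) 1, ‖(cfTwist A hA q (cfDimension A : ℂ) ^ n) F ξ x - (cfTwist A hA q (cfDimension A : ℂ) ^ n) F ξ y‖ ≤
        2 * (4 : ℝ) ^ cfDimension A * (4 * cfDimension A * Real.exp (4 * cfDimension A) + 1) * ‖F‖ * |(x : ℝ) - y| := by
  obtain ⟨hbu, hbv, hlu, hlv⟩ := cfReFam_cfImFam_bounds q F
  have hF0 := norm_nonneg F
  have hδ := (cfDimension_pos hA h2).le
  refine ⟨fun x => ?_, fun x y => ?_⟩
  · rw [cfTwist_pow_apply_re_im]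
    have h1 := abs_cfTwistSumR_le_sup A hA h2 q hbu n ξ x.2
    have h2' := abs_cfTwistSumR_le_sup A hA h2 q hbv n ξ x.2
    refine (norm_add_le _ _).trans ?_
    rw [norm_mul, Complex.norm_I, mul_one, Complex.norm_real, Complex.norm_real, Real.norm_eq_abs, Real.norm_eq_abs]
    linarith
  · rw [cfTwist_pow_apply_re_im, cfTwist_pow_apply_re_im]
    have h1 := cfTwistSumR_lasotaYorke A hA h2 q hF0 hF0 hbu hlu n ξ x.2 y.2
    have h2' := cfTwistSumR_lasotaYorke A hA h2 q hF0 hF0 hbv hlv n ξ x.2 y.2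
    have e : ∀ a b c d : ℝ, ((a : ℂ) + (b : ℂ) * Complex.I) - ((c : ℂ) + (d : ℂ) * Complex.I) =
        ((a - c : ℝ) : ℂ) + ((b - d : ℝ) : ℂ) * Complex.I := by intros; push_cast; ring
    rw [e]
    refine (norm_add_le _ _).trans ?_
    rw [norm_mul, Complex.norm_I, mul_one, Complex.norm_real, Complex.norm_real, Real.norm_eq_abs, Real.norm_eq_abs]
    have hhalf : (1 / 2 : ℝ) ^ n * ‖F‖ ≤ 1 * ‖F‖ :=
      mul_le_mul_of_nonneg_right (pow_le_one₀ (by norm_num) (by norm_num)) hF0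
    have hmono : (4 : ℝ) ^ cfDimension A * (4 * cfDimension A * Real.exp (4 * cfDimension A) * ‖F‖ + (1 / 2 : ℝ) ^ n * ‖F‖) * |(x : ℝ) - y| ≤
        (4 : ℝ) ^ cfDimension A * (4 * cfDimension A * Real.exp (4 * cfDimension A) + 1) * ‖F‖ * |(x : ℝ) - y| := by
      have : (4 : ℝ) ^ cfDimension A * (4 * cfDimension A * Real.exp (4 * cfDimension A) * ‖F‖ + (1 / 2 : ℝ) ^ n * ‖F‖) ≤
          (4 : ℝ) ^ cfDimension A * (4 * cfDimension A * Real.exp (4 * cfDimension A) + 1) * ‖F‖ := by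
        rw [mul_assoc ((4 : ℝ) ^ cfDimension A)]
        refine mul_le_mul_of_nonneg_left ?_ (by positivity)
        nlinarith
      exact mul_le_mul_of_nonneg_right this (abs_nonneg _)
    linarith

include h2 in
/-- **Uniform bound for the powers in operator norm:** `‖𝓜ⁿ‖ ≤ 2·4^δ (4δe^{4δ} + 2)`.
[cite: MageeOhWinter2019, Lemma 15] -/
theorem norm_cfTwist_pow_le (n : ℕ) :
    ‖cfTwist A hA q (cfDimension A : ℂ) ^ n‖ ≤ 2 * (4 : ℝ) ^ cfDimension A * (4 * cfDimension A * Real.exp (4 * cfDimension A) + 2) := by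
  have hδ := (cfDimension_pos hA h2).le
  refine ContinuousLinearMap.opNorm_le_bound _ (by positivity) fun F => ?_
  rw [pi_norm_le_iff_of_nonneg (by positivity)]
  intro ξ
  obtain ⟨hsup, hlip⟩ := cfTwist_pow_apply_bounds A hA h2 n F ξ
  refine (CfLip.norm_le_of_bounds (by positivity) hsup hlip).trans (le_of_eq ?_)
  ring

/-! ### `Π_q` and `𝓜` -/

include h2 in
omit [NeZero q] in
/-- `𝓜 (h ⊗ 𝟙) = h ⊗ 𝟙`. [cite: MageeOhWinter2019, §3.2] -/
theorem cfTwist_const_cfHL : cfTwist A hA q (cfDimension A : ℂ) (fun _ => cfHL A hA h2) = fun _ => cfHL A hA h2 := by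
  funext ξ
  rw [cfTwist_const, sq, ContinuousLinearMap.mul_def, ContinuousLinearMap.coe_comp, Function.comp_apply, cfLOp_cfHL, cfLOp_cfHL]

include h2 in
/-- **`𝓜 Π_q = Π_q`.** [cite: MageeOhWinter2019, §3.2] -/
theorem cfTwist_cfTwPi : cfTwist A hA q (cfDimension A : ℂ) * cfTwPi A hA h2 = cfTwPi A hA h2 := by
  refine ContinuousLinearMap.ext fun F => funext fun ξ => ?_
  rw [ContinuousLinearMap.mul_def, ContinuousLinearMap.coe_comp, Function.comp_apply]
  have h : cfTwPi A hA h2 F = fun _ => ((Fintype.card (SL(2, ZMod q)) : ℂ)⁻¹ * ∑ η, cfNuL A hA h2 (F η)) • cfHL A hA h2 :=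
    funext fun η => cfTwPi_apply A hA h2 F η
  rw [h, cfTwist_const, map_smul, sq, ContinuousLinearMap.mul_def, ContinuousLinearMap.coe_comp, Function.comp_apply,
    cfLOp_cfHL, cfLOp_cfHL]

include h2 in
/-- **`Π_q 𝓜 = Π_q`** (invariance of the averaged eigenfunctional). [cite: MageeOhWinter2019, §3.2] -/
theorem cfTwPi_cfTwist : cfTwPi A hA h2 * cfTwist A hA q (cfDimension A : ℂ) = cfTwPi A hA h2 := by
  refine ContinuousLinearMap.ext fun F => funext fun ξ => ?_
  rw [ContinuousLinearMap.mul_def, ContinuousLinearMap.coe_comp, Function.comp_apply, cfTwPi_apply, cfTwPi_apply]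
  congr 2
  rw [← map_sum, ← map_sum, sum_cfTwist_apply, sq, ContinuousLinearMap.mul_def, ContinuousLinearMap.coe_comp,
    Function.comp_apply, cfNuL_cfLOp, cfNuL_cfLOp]

include h2 in
/-- **`Π_q² = Π_q`.** [cite: MageeOhWinter2019, §3.2] -/
theorem cfTwPi_idem : cfTwPi A hA h2 * cfTwPi A hA h2 = (cfTwPi A hA h2 : (SL(2, ZMod q) → CfLip) →L[ℂ] _) := by
  refine ContinuousLinearMap.ext fun F => funext fun ξ => ?_
  rw [ContinuousLinearMap.mul_def, ContinuousLinearMap.coe_comp, Function.comp_apply, cfTwPi_apply, cfTwPi_apply]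
  congr 1
  simp_rw [cfTwPi_apply, map_smul, cfNuL_cfHL, smul_eq_mul, mul_one, Finset.sum_const, Finset.card_univ, nsmul_eq_mul]
  have hcard : (Fintype.card (SL(2, ZMod q)) : ℂ) ≠ 0 := by exact_mod_cast Fintype.card_ne_zero
  field_simp

include h2 in
/-- `𝓜ⁿ Π_q = Π_q`. [cite: MageeOhWinter2019, §3.2] -/
theorem cfTwist_pow_cfTwPi (n : ℕ) : cfTwist A hA q (cfDimension A : ℂ) ^ n * cfTwPi A hA h2 = cfTwPi A hA h2 := by
  induction n with
  | zero => rw [pow_zero, one_mul]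
  | succ n ih => rw [pow_succ, mul_assoc, cfTwist_cfTwPi A hA h2, ih]

include h2 in
/-- Norm of the projection: `‖Π_q‖ ≤ ‖h‖`. [folklore] -/
theorem norm_cfTwPi_le : ‖(cfTwPi A hA h2 : (SL(2, ZMod q) → CfLip) →L[ℂ] _)‖ ≤ ‖cfHL A hA h2‖ := by
  refine ContinuousLinearMap.opNorm_le_bound _ (norm_nonneg _) fun F => ?_
  rw [pi_norm_le_iff_of_nonneg (by positivity)]
  intro ξ
  rw [cfTwPi_apply, norm_smul]
  have hcard : (0 : ℝ) < Fintype.card (SL(2, ZMod q)) := by exact_mod_cast Fintype.card_pos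
  have hcoef : ‖(Fintype.card (SL(2, ZMod q)) : ℂ)⁻¹ * ∑ η, cfNuL A hA h2 (F η)‖ ≤ ‖F‖ := by
    rw [norm_mul, norm_inv, Complex.norm_natCast]
    have hs : ‖∑ η, cfNuL A hA h2 (F η)‖ ≤ ∑ _η : SL(2, ZMod q), ‖F‖ := by
      refine (norm_sum_le _ _).trans (Finset.sum_le_sum fun η _ => ?_)
      calc ‖cfNuL A hA h2 (F η)‖ ≤ ‖cfNuL A hA h2‖ * ‖F η‖ := ContinuousLinearMap.le_opNorm _ _
        _ ≤ 1 * ‖F‖ := mul_le_mul (norm_cfNuL_le A hA h2) (norm_le_pi_norm F η) (norm_nonneg _) zero_le_one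
        _ = ‖F‖ := one_mul _
    rw [Finset.sum_const, Finset.card_univ, nsmul_eq_mul] at hs
    calc (Fintype.card (SL(2, ZMod q)) : ℝ)⁻¹ * ‖∑ η, cfNuL A hA h2 (F η)‖
        ≤ (Fintype.card (SL(2, ZMod q)) : ℝ)⁻¹ * (Fintype.card (SL(2, ZMod q)) * ‖F‖) :=
          mul_le_mul_of_nonneg_left hs (inv_nonneg.2 hcard.le)
      _ = ‖F‖ := by field_simp
  calc ‖(Fintype.card (SL(2, ZMod q)) : ℂ)⁻¹ * ∑ η, cfNuL A hA h2 (F η)‖ * ‖cfHL A hA h2‖ ≤ ‖F‖ * ‖cfHL A hA h2‖ :=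
        mul_le_mul_of_nonneg_right hcoef (norm_nonneg _)
    _ = ‖cfHL A hA h2‖ * ‖F‖ := mul_comm _ _

/-! ### The operator-norm gap -/

include h2 in
/-- **The spectral gap of the congruence transfer operator in operator norm (fixed `q`):** if the
twists are primitive (e.g. `q` prime to `6 (b - a)`, `cfTwist_primitive`), there are `C ≥ 0` and
`r < 1` with `‖𝓜ⁿ - Π_q‖ ≤ C rⁿ` on `SL₂(ℤ/qℤ) → CfLip`. [cite: MageeOhWinter2019, §3.2, Thm. 10] -/
theorem cfTwist_opGap {n₀ : ℕ}
    (hprim : ∀ n ≥ n₀, ∀ ξ η : SL(2, ZMod q), ∃ w : List (A × A), w.length = n ∧ ξ * cfSigmaWord A q w = η) :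
    ∃ C r : ℝ, 0 ≤ C ∧ 0 < r ∧ r < 1 ∧
      ∀ n : ℕ, ‖cfTwist A hA q (cfDimension A : ℂ) ^ n - cfTwPi A hA h2‖ ≤ C * r ^ n := by
  have hδ := (cfDimension_pos hA h2).le
  set N := max n₀ 1 with hNdef
  have hN : n₀ ≤ N := le_max_left _ _
  have hN1 : 1 ≤ N := le_max_right _ _
  obtain ⟨hη0, hη4⟩ := cfTwEta_pos_le A hA h2 N
  set b := 1 - cfTwEta A N with hb
  have hb0 : 0 < b := by rw [hb]; linarith
  have hb1 : b < 1 := by rw [hb]; linarith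
  -- constants
  set D := (4 : ℝ) ^ cfDimension A * (Real.exp (4 * cfDimension A + 2) * Fintype.card (SL(2, ZMod q)) +
        Real.exp (2 * cfDimension A)) with hD
  set K₁ := 2 * (4 : ℝ) ^ cfDimension A * (4 * cfDimension A * Real.exp (4 * cfDimension A) + 2) with hK₁
  set c₁ := 4 * cfDimension A * Real.exp (4 * cfDimension A) with hc₁
  have hD0 : 0 ≤ D := by positivity
  have hK10 : 0 ≤ K₁ := by positivity
  have hc10 : 0 ≤ c₁ := by positivity
  -- rates: `b^{⌊m'/N⌋}` with `m' ≥ n/2` and `2^{-m}` with `m = ⌊n/2⌋`; both `≤ const · r^n`, `r = max(b^{1/(2N)}, 2^{-1/2})`... we use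
  -- the cruder `r₁ = b^{1/(2N)}` via `pow_div_le_rpow` twice and `r₂ = (1/2)^{1/2}`.
  set r₁ := (b ^ ((N : ℝ)⁻¹)) ^ ((2 : ℝ)⁻¹) with hr₁
  set r₂ := ((1 / 2 : ℝ)) ^ ((2 : ℝ)⁻¹) with hr₂
  have hbN0 : 0 < b ^ ((N : ℝ)⁻¹) := Real.rpow_pos_of_pos hb0 _
  have hbN1 : b ^ ((N : ℝ)⁻¹) < 1 := Real.rpow_lt_one hb0.le hb1 (by positivity)
  have hr₁0 : 0 < r₁ := Real.rpow_pos_of_pos hbN0 _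
  have hr₁1 : r₁ < 1 := Real.rpow_lt_one hbN0.le hbN1 (by norm_num)
  have hr₂0 : 0 < r₂ := Real.rpow_pos_of_pos (by norm_num) _
  have hr₂1 : r₂ < 1 := Real.rpow_lt_one (by norm_num) (by norm_num) (by norm_num)
  set r := max r₁ r₂ with hr
  have hr0 : 0 < r := lt_max_of_lt_left hr₁0
  have hr1 : r < 1 := max_lt hr₁1 hr₂1
  -- geometric conversions: for `m' = n - n/2 ≥ n/2`: `b^{m'/N} ≤ b⁻¹ (b^{1/N})^{m'} ≤ b⁻¹ (b^{1/N})^{n/2}`; and `(b^{1/N})^{n/2} ≤ (b^{1/N})⁻¹ r₁^n`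
  have key1 : ∀ n : ℕ, b ^ ((n - n / 2) / N) ≤ b⁻¹ * (b ^ ((N : ℝ)⁻¹))⁻¹ * r ^ n := by
    intro n
    have h1 := pow_div_le_rpow hb0 hb1 hN1 (n - n / 2)
    have h2' : (b ^ ((N : ℝ)⁻¹)) ^ (n - n / 2) ≤ (b ^ ((N : ℝ)⁻¹)) ^ (n / 2) :=
      pow_le_pow_of_le_one hbN0.le hbN1.le (by omega)
    have h3 := pow_div_le_rpow hbN0 hbN1 (by norm_num : 1 ≤ 2) n
    have h3' : (b ^ ((N : ℝ)⁻¹)) ^ (n / 2) ≤ (b ^ ((N : ℝ)⁻¹))⁻¹ * r ^ n := by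
      refine h3.trans (mul_le_mul_of_nonneg_left ?_ (inv_nonneg.2 hbN0.le))
      rw [show ((2 : ℕ) : ℝ)⁻¹ = (2 : ℝ)⁻¹ by norm_num, ← hr₁]
      exact pow_le_pow_left₀ hr₁0.le (le_max_left _ _) n
    calc b ^ ((n - n / 2) / N) ≤ b⁻¹ * (b ^ ((N : ℝ)⁻¹)) ^ (n - n / 2) := h1
      _ ≤ b⁻¹ * (b ^ ((N : ℝ)⁻¹)) ^ (n / 2) := mul_le_mul_of_nonneg_left h2' (inv_nonneg.2 hb0.le)
      _ ≤ b⁻¹ * ((b ^ ((N : ℝ)⁻¹))⁻¹ * r ^ n) := mul_le_mul_of_nonneg_left h3' (inv_nonneg.2 hb0.le)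
      _ = _ := by ring
  have key2 : ∀ n : ℕ, (1 / 2 : ℝ) ^ (n / 2) ≤ 2 * r ^ n := by
    intro n
    have h3 := pow_div_le_rpow (b := (1 / 2 : ℝ)) (by norm_num) (by norm_num) (by norm_num : 1 ≤ 2) n
    refine h3.trans ?_
    rw [show ((1 / 2 : ℝ))⁻¹ = 2 by norm_num, show ((2 : ℕ) : ℝ)⁻¹ = (2 : ℝ)⁻¹ by norm_num, ← hr₂]
    exact mul_le_mul_of_nonneg_left (pow_le_pow_left₀ hr₂0.le (le_max_right _ _) n) (by norm_num)
  set E₁ := b⁻¹ * (b ^ ((N : ℝ)⁻¹))⁻¹ with hE₁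
  have hE₁0 : 0 ≤ E₁ := by positivity
  -- the final constant
  set C := 2 * (4 : ℝ) ^ cfDimension A * (20 * D * E₁) * (1 + c₁) +
      2 * (4 : ℝ) ^ cfDimension A * (2 * (K₁ + ‖cfHL A hA h2‖)) with hC
  refine ⟨C, r, by positivity, hr0, hr1, fun n => ?_⟩
  set T := cfTwist A hA q (cfDimension A : ℂ) with hT
  set P := cfTwPi A hA h2 (q := q) with hP
  set m := n / 2 with hm
  set m' := n - n / 2 with hm'
  have hnm : n = m + m' := by omega
  have hsplit : T ^ n - P = T ^ m * (T ^ m' - P) := by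
    rw [mul_sub, ← pow_add, ← hnm, hT, hP, cfTwist_pow_cfTwPi A hA h2]
  rw [hsplit]
  refine ContinuousLinearMap.opNorm_le_bound _ (by positivity) fun F => ?_
  set G := (T ^ m' - P) F with hG
  have hF := norm_nonneg F
  -- sup bound on `G`
  have hGsup : ∀ η, ∀ y ∈ Icc (0 : ℝ) 1, ‖(G η).extend y‖ ≤ 20 * D * b ^ (m' / N) * ‖F‖ := by
    intro η y hy
    rw [CfLip.extend_of_mem _ hy, hG]
    have h := norm_cfTwist_pow_apply_sub_le A hA h2 hprim hN hN1 F m' η ⟨y, hy⟩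
    rw [← hD, ← hb] at h
    show ‖((T ^ m') F η - P F η) ⟨y, hy⟩‖ ≤ _
    rw [CfLip.sub_apply]; exact h
  -- norm bound on `G`
  have hGnorm : ‖G‖ ≤ (K₁ + ‖cfHL A hA h2‖) * ‖F‖ := by
    rw [hG]
    calc ‖(T ^ m' - P) F‖ ≤ ‖T ^ m' - P‖ * ‖F‖ := ContinuousLinearMap.le_opNorm _ _
      _ ≤ (‖T ^ m'‖ + ‖P‖) * ‖F‖ := mul_le_mul_of_nonneg_right (norm_sub_le _ _) hF
      _ ≤ (K₁ + ‖cfHL A hA h2‖) * ‖F‖ :=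
          mul_le_mul_of_nonneg_right (add_le_add (norm_cfTwist_pow_le A hA h2 m') (norm_cfTwPi_le A hA h2)) hF
  -- real/imag families of `G`: sup ≤ MG, Lip ≤ ‖G‖
  set MG := 20 * D * b ^ (m' / N) * ‖F‖ with hMG
  have hMG0 : 0 ≤ MG := by positivity
  have hbuG : ∀ η, ∀ y ∈ Icc (0 : ℝ) 1, |cfReFam q G η y| ≤ MG := fun η y hy =>
    (Complex.abs_re_le_norm _).trans (hGsup η y hy)
  have hbvG : ∀ η, ∀ y ∈ Icc (0 : ℝ) 1, |cfImFam q G η y| ≤ MG := fun η y hy =>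
    (Complex.abs_im_le_norm _).trans (hGsup η y hy)
  obtain ⟨-, -, hluG, hlvG⟩ := cfReFam_cfImFam_bounds q G
  have hG0 := norm_nonneg G
  -- bounds for `T^m G`
  have hval : ∀ (ξ : SL(2, ZMod q)) (x : Icc (0 : ℝ) 1), (T ^ m * (T ^ m' - P)) F ξ x =
      ((cfTwistSumR A q m (cfReFam q G) ξ x : ℝ) : ℂ) + ((cfTwistSumR A q m (cfImFam q G) ξ x : ℝ) : ℂ) * Complex.I := by
    intro ξ x
    rw [ContinuousLinearMap.mul_def, ContinuousLinearMap.coe_comp, Function.comp_apply, ← hG, hT,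
      cfTwist_pow_apply_re_im A hA q m G ξ x]
  have hsup : ∀ (ξ : SL(2, ZMod q)) (x : Icc (0 : ℝ) 1), ‖(T ^ m * (T ^ m' - P)) F ξ x‖ ≤ 2 * (4 : ℝ) ^ cfDimension A * MG := by
    intro ξ x
    rw [hval]
    have h1 := abs_cfTwistSumR_le_sup A hA h2 q hbuG m ξ x.2
    have h2' := abs_cfTwistSumR_le_sup A hA h2 q hbvG m ξ x.2
    refine (norm_add_le _ _).trans ?_
    rw [norm_mul, Complex.norm_I, mul_one, Complex.norm_real, Complex.norm_real, Real.norm_eq_abs, Real.norm_eq_abs]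
    linarith
  have hlip : ∀ (ξ : SL(2, ZMod q)) (x y : Icc (0 : ℝ) 1),
      ‖(T ^ m * (T ^ m' - P)) F ξ x - (T ^ m * (T ^ m' - P)) F ξ y‖ ≤
        2 * (4 : ℝ) ^ cfDimension A * (c₁ * MG + (1 / 2 : ℝ) ^ m * ((K₁ + ‖cfHL A hA h2‖) * ‖F‖)) * |(x : ℝ) - y| := by
    intro ξ x y
    rw [hval, hval]
    have h1 := cfTwistSumR_lasotaYorke A hA h2 q hMG0 hG0 hbuG hluG m ξ x.2 y.2
    have h2' := cfTwistSumR_lasotaYorke A hA h2 q hMG0 hG0 hbvG hlvG m ξ x.2 y.2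
    rw [← hc₁] at h1 h2'
    have e : ∀ a b c d : ℝ, ((a : ℂ) + (b : ℂ) * Complex.I) - ((c : ℂ) + (d : ℂ) * Complex.I) =
        ((a - c : ℝ) : ℂ) + ((b - d : ℝ) : ℂ) * Complex.I := by intros; push_cast; ring
    rw [e]
    refine (norm_add_le _ _).trans ?_
    rw [norm_mul, Complex.norm_I, mul_one, Complex.norm_real, Complex.norm_real, Real.norm_eq_abs, Real.norm_eq_abs]
    have hmono : (4 : ℝ) ^ cfDimension A * (c₁ * MG + (1 / 2 : ℝ) ^ m * ‖G‖) * |(x : ℝ) - y| ≤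
        (4 : ℝ) ^ cfDimension A * (c₁ * MG + (1 / 2 : ℝ) ^ m * ((K₁ + ‖cfHL A hA h2‖) * ‖F‖)) * |(x : ℝ) - y| := by
      gcongr
    linarith
  set R := 2 * (4 : ℝ) ^ cfDimension A * MG +
      2 * (4 : ℝ) ^ cfDimension A * (c₁ * MG + (1 / 2 : ℝ) ^ m * ((K₁ + ‖cfHL A hA h2‖) * ‖F‖)) with hR
  have h4 : 0 ≤ (4 : ℝ) ^ cfDimension A := by positivity
  have hX : 0 ≤ (1 / 2 : ℝ) ^ m * ((K₁ + ‖cfHL A hA h2‖) * ‖F‖) := by positivity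
  have hcM : 0 ≤ c₁ * MG := mul_nonneg hc10 hMG0
  have hLipC : 0 ≤ 2 * (4 : ℝ) ^ cfDimension A * (c₁ * MG + (1 / 2 : ℝ) ^ m * ((K₁ + ‖cfHL A hA h2‖) * ‖F‖)) :=
    mul_nonneg (mul_nonneg two_pos.le h4) (add_nonneg hcM hX)
  have hR0 : 0 ≤ R := by
    rw [hR]
    exact add_nonneg (mul_nonneg (mul_nonneg two_pos.le h4) hMG0) hLipC
  have hbound : ‖(T ^ m * (T ^ m' - P)) F‖ ≤ R := by
    refine (pi_norm_le_iff_of_nonneg hR0).2 fun ξ => ?_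
    have h := CfLip.norm_le_of_bounds hLipC (hsup ξ) (hlip ξ)
    rw [hR]
    exact h
  refine hbound.trans ?_
  -- convert the rates
  have e1 : MG ≤ 20 * D * (E₁ * r ^ n) * ‖F‖ := by
    rw [hMG]
    have := key1 n
    rw [← hm'] at this
    gcongr
  have e2 : (1 / 2 : ℝ) ^ m * ((K₁ + ‖cfHL A hA h2‖) * ‖F‖) ≤ (2 * r ^ n) * ((K₁ + ‖cfHL A hA h2‖) * ‖F‖) :=
    mul_le_mul_of_nonneg_right (key2 n) (mul_nonneg (add_nonneg hK10 (norm_nonneg _)) hF)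
  have h24 : 0 ≤ 2 * (4 : ℝ) ^ cfDimension A := mul_nonneg two_pos.le h4
  rw [hR]
  calc 2 * (4 : ℝ) ^ cfDimension A * MG +
        2 * (4 : ℝ) ^ cfDimension A * (c₁ * MG + (1 / 2 : ℝ) ^ m * ((K₁ + ‖cfHL A hA h2‖) * ‖F‖))
      ≤ 2 * (4 : ℝ) ^ cfDimension A * (20 * D * (E₁ * r ^ n) * ‖F‖) +
          2 * (4 : ℝ) ^ cfDimension A * (c₁ * (20 * D * (E₁ * r ^ n) * ‖F‖) + (2 * r ^ n) * ((K₁ + ‖cfHL A hA h2‖) * ‖F‖)) :=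
        add_le_add (mul_le_mul_of_nonneg_left e1 h24)
          (mul_le_mul_of_nonneg_left (add_le_add (mul_le_mul_of_nonneg_left e1 hc10) e2) h24)
    _ = C * r ^ n * ‖F‖ := by rw [hC]; ring

end OpGap

end Literature.NumberTheory.Sieve
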